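import Summits.Ventures.CertifiedManyBodySolver.Downfold.EmeryScaleBoxChain
import HarnessLib

/-!
# ASSEMBLY LEMMAS FOR THE SCALE-COORDINATE CHAIN DATA: a stage check from per-cell checks, a chain check from per-stage checks — so that an instance
# file can decide the kernel data ONE CELL AT A TIME (each `decide` inside the default heartbeat budget) (INFL-3to1-B §B.88 (s′))

Venture CertifiedManyBodySolver, cell `pub/hubbard-downfold` (stage S1; INFLATION-RULES-3to1-B §B.88), seat hubbard-downfold-mod-4 (technique B = band
level, g36); namespace `Summit.Ventures.CertifiedManyBodySolver.Downfold.Emery`. Everything PROVED (0 sorry, no definition). WHAT THIS IS NOT: a statement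
about any material; no number lives here.

* `stageCheck_of_cells`: `covers 0 w cells` and `cellOK … c` for every `c ∈ cells` ⇒ `stageCheck … w cells`.
* `chainCheckUpper_of_parts` / `chainCheckLower_of_parts`: the `t_pd` stage on the corner family, and for every `t_pd`-node its `t_pp` stage and for every
  `t_pp`-node its `Δ` stage ⇒ `chainCheckUpper` / `chainCheckLower` (the definitions unfolded into their conjuncts; kernel budget ≈ 900 leaf evaluations
  per `decide`, measured 2026-08-31).

Sources: arithmetic [folklore].
-/

noncomputable section

namespace Summit.Ventures.CertifiedManyBodySolver.Downfold.Emery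

open Real Set Literature.Analysis.ValidatedNumerics.Numerics

/-- A stage check from its cells. [folklore] -/
theorem stageCheck_of_cells {upper : Bool} {dD dA dB cN cP : FI} {whlo : ℤ} {famD famA famB W : FI} {w : ℤ} {cells : List SCell}
    (hcov : covers 0 w cells = true) (hall : ∀ c ∈ cells, cellOK upper dD dA dB cN cP whlo famD famA famB W c = true) :
    stageCheck upper dD dA dB cN cP whlo famD famA famB W w cells = true := by
  unfold stageCheck
  rw [Bool.and_eq_true, List.all_eq_true]
  exact ⟨hcov, hall⟩

/-- The UPPER chain check from its stages. [folklore] -/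
theorem chainCheckUpper_of_parts {cN cP : FI} {whlo : ℤ} {ID1 IA2 IB2 : FI} {wA wB wD : ℤ} {W0 : FI} {nodes : List ANode}
    (hA : stageCheck true (thin 0) (thin (-(SC : ℤ))) (thin 0) cN cP whlo ID1 IA2 IB2 W0 wA (nodes.map (·.cell)) = true)
    (hBC : ∀ na ∈ nodes,
      stageCheck true (thin 0) (thin 0) (thin (-(SC : ℤ))) cN cP whlo ID1 (famOf IA2 na.cell.iS (thin (-(SC : ℤ)))) IB2 na.cell.Wout wB
          (na.sub.map (·.cell)) = true ∧
        ∀ nb ∈ na.sub, stageCheck true (thin (SC : ℤ)) (thin 0) (thin 0) cN cP whlo ID1 (famOf IA2 na.cell.iS (thin (-(SC : ℤ))))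
          (famOf IB2 nb.cell.iS (thin (-(SC : ℤ)))) nb.cell.Wout wD nb.sub = true) :
    chainCheckUpper cN cP whlo ID1 IA2 IB2 wA wB wD W0 nodes = true := by
  unfold chainCheckUpper
  rw [Bool.and_eq_true, List.all_eq_true]
  refine ⟨hA, fun na hna => ?_⟩
  rw [Bool.and_eq_true, List.all_eq_true]
  exact ⟨(hBC na hna).1, fun nb hnb => (hBC na hna).2 nb hnb⟩

/-- The LOWER chain check from its stages. [folklore] -/
theorem chainCheckLower_of_parts {cN cP : FI} {ID2 IA1 IB1 : FI} {wA wB wD : ℤ} {W0 : FI} {nodes : List ANode}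
    (hA : stageCheck false (thin 0) (thin (SC : ℤ)) (thin 0) cN cP 0 ID2 IA1 IB1 W0 wA (nodes.map (·.cell)) = true)
    (hBC : ∀ na ∈ nodes,
      stageCheck false (thin 0) (thin 0) (thin (SC : ℤ)) cN cP 0 ID2 (famOf IA1 na.cell.iS (thin (SC : ℤ))) IB1 na.cell.Wout wB
          (na.sub.map (·.cell)) = true ∧
        ∀ nb ∈ na.sub, stageCheck false (thin (-(SC : ℤ))) (thin 0) (thin 0) cN cP 0 ID2 (famOf IA1 na.cell.iS (thin (SC : ℤ)))
          (famOf IB1 nb.cell.iS (thin (SC : ℤ))) nb.cell.Wout wD nb.sub = true) :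
    chainCheckLower cN cP ID2 IA1 IB1 wA wB wD W0 nodes = true := by
  unfold chainCheckLower
  rw [Bool.and_eq_true, List.all_eq_true]
  refine ⟨hA, fun na hna => ?_⟩
  rw [Bool.and_eq_true, List.all_eq_true]
  exact ⟨(hBC na hna).1, fun nb hnb => (hBC na hna).2 nb hnb⟩

end Summit.Ventures.CertifiedManyBodySolver.Downfold.Emery
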